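import Summits.HodgeConjecture.CorCM.GaloisDicyclicBinders
import Summits.HodgeConjecture.CorCM.AbelianCyclicTimesTwoHalfSums
import HarnessLib

/-!
# Galois CM fields with Galois group `Q_{2^{k+2}} × C₂` (complex conjugation in the quaternion factor): every
# primitive CM type is nondegenerate

COR-CM (cell `pub-hodgecm2`), binder seat b04 (gen 20), count-neutral claim DICYCLIC-TWO-SHEET, part IX; sequel of
part IV (`CorCM/GaloisDicyclicNondegenerate`: `Q_{2^{k+2}} = Dic_{2^k}` alone — every CM type nondegenerate) with the
abelian input of part VIII (`CorCM/AbelianCyclicTimesTwoHalfSums`).  KERNEL ONLY: theorems; no definition, no named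
fact, no `sorry`.  `HC_CM` is neither used nor claimed.

SETTING.  `G = Q_{2^{k+2}} × C₂ = QuaternionGroup n × Multiplicative (ZMod 2)`, `n = 2^k`, complex conjugation
`c = (a n, 1)` (the central involution IN the quaternion factor: `K = K₁ · F` with `K₁` a quaternion CM field of degree
`2^{k+2}` and `F = K^{Q × 1}` a REAL quadratic field; the other two central involutions `(1, z)`, `(a n, z)` give `K` an
imaginary quadratic subfield and fall under gen 19's capstone — degenerate).  Two sheets over the abelian subgroup
`A = ⟨a⟩ × C₂ ≅ ℤ/2^{k+1} × ℤ/2` of index `2` (`x = (xa 0, 1)`, `x u x⁻¹ = u⁻¹`, `x² = c`): the determinant is again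
`|Ŝ₁(χ)|² + |Ŝ₂(χ)|²`, and by part VIII two sheets killed by the same odd `χ` are both stable under the translation
`τ_χ ∈ {(n,1), (0,1)}` — a LEFT STABILISER `(a n, z)` or `(1, z)` of the type: imprimitive.

* `eq_zero_of_annihilated_quaternion_times_two` (group level), **`isNondegenerate_of_isPrimitive_quaternion_times_two`**
  (every PRIMITIVE CM type of such `K` is nondegenerate, rank `4n + 1`), the Hodge conjecture for all powers of every
  SIMPLE abelian variety of dimension `4n = 2^{k+2}` with CM by `K` (`hodgeConjectureFor_pow_of_isSimple_quaternion_times_two`),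
  and §3 the `End⁰`-action binder + `HCOnClass` display (format of part VI).
  Seat census: `Q₈ × C₂` 224 ∕ 0 (gen 16, by tables), `Q₁₆ × C₂` 0 degenerate of 1492 sampled primitive; the factor `C₂`
  is sharp (`Q₈ × C₂²`, `Q₈ × C₄`, `Q₈ × C₃` carry primitive degenerate types).

## References

* [Kubota1965] T. Kubota, Trans. AMS 118 (1965), §2, §4 Lemma 2.
* [Shimura1998] G. Shimura, *Abelian Varieties with Complex Multiplication and Modular Functions*, §8.2 Prop. 26.
* [Gordon1999HodgeAVSurvey] B. B. Gordon, *A survey of the Hodge conjecture for abelian varieties*, Thm. 6.4, §9.4.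
-/

noncomputable section

open CategoryTheory CategoryTheory.Limits NumberField
open scoped BigOperators

namespace Summit.HodgeConjecture.CorCM.GaloisDicyclic

open Literature.NumberTheory.ComplexMultiplication
open Literature.AlgebraicGeometry.Motives (AbelianVariety CMType)
open Literature.AlgebraicGeometry.HodgeTheory
open Literature.AlgebraicGeometry.ComplexMultiplication (IsCMTypeRealisation isSimple_iff_isPrimitive)
open Literature.AlgebraicGeometry.Pohlmann1968
open Summit.HodgeConjecture.CorCM.GaloisRank
open Summit.HodgeConjecture.CorCM.CyclicTwoPower
open QuaternionGroup AddChar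

/-! ## §1 The two-sheet model on `Q_{2^{k+2}} × C₂` -/

section Model

variable {n : ℕ} [NeZero n]

/-- In `Multiplicative (ZMod 2)` every element is its own inverse. [folklore] -/
theorem inv_eq_self_zmod_two (t : Multiplicative (ZMod 2)) : t⁻¹ = t := by
  change Multiplicative.ofAdd (-(Multiplicative.toAdd t)) = t
  rw [ZMod.neg_eq_self_mod_two, ofAdd_toAdd]

/-- **`Q_{2^{k+2}} × C₂`, `c = (a n, 1)`, `n = 2^k`: if neither `(a n, z)` nor `(1, z)` is a left stabiliser of the CM
set `S`, every `c`-antisymmetric weight annihilated by the right translates of `S` vanishes.**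
[cite: Kubota1965, §4 Lemma 2] -/
theorem eq_zero_of_annihilated_quaternion_times_two {k : ℕ} (hn : n = 2 ^ k)
    (S : Finset (QuaternionGroup n × Multiplicative (ZMod 2)))
    (hScm : ∀ y : QuaternionGroup n × Multiplicative (ZMod 2), (a n, 1) * y ∈ S ↔ y ∉ S)
    (hstab₁ : ¬ ∀ w : QuaternionGroup n × Multiplicative (ZMod 2),
      w ∈ S ↔ ((a n, Multiplicative.ofAdd 1) : QuaternionGroup n × Multiplicative (ZMod 2)) * w ∈ S)
    (hstab₂ : ¬ ∀ w : QuaternionGroup n × Multiplicative (ZMod 2),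
      w ∈ S ↔ ((1, Multiplicative.ofAdd 1) : QuaternionGroup n × Multiplicative (ZMod 2)) * w ∈ S)
    (b : QuaternionGroup n × Multiplicative (ZMod 2) → ℚ) (hb : ∀ g, b ((a n, 1) * g) = -b g)
    (hann : ∀ g, ∑ s ∈ S, b (s * g) = 0) : b = 0 := by
  classical
  -- the abelian subgroup `⟨a⟩ × C₂ ≅ ℤ/2n × ℤ/2`
  let i : Multiplicative (ZMod (2 * n)) × Multiplicative (ZMod 2) →* QuaternionGroup n × Multiplicative (ZMod 2) :=
    MonoidHom.mk' (fun u => (a (Multiplicative.toAdd u.1), u.2)) fun u v => by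
      simp [toAdd_mul]
  have hi_apply : ∀ u, i u = (a (Multiplicative.toAdd u.1), u.2) := fun u => rfl
  have hi : Function.Injective i := by
    rintro ⟨u₁, u₂⟩ ⟨v₁, v₂⟩ h
    simp only [hi_apply, Prod.mk.injEq] at h
    obtain ⟨h1, h2⟩ := h
    have h1' : Multiplicative.toAdd u₁ = Multiplicative.toAdd v₁ := a.inj h1
    exact Prod.ext (by simpa using h1') h2
  have hx : ∀ u, i u ≠ (xa 0, 1) := fun u => by simp [hi_apply]
  have hcov : ∀ g : QuaternionGroup n × Multiplicative (ZMod 2), (∃ u, g = i u) ∨ (∃ u, g = i u * (xa 0, 1)) := by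
    rintro ⟨j | j, t⟩
    · exact Or.inl ⟨(Multiplicative.ofAdd j, t), by simp [hi_apply]⟩
    · exact Or.inr ⟨(Multiplicative.ofAdd (-j), t), by simp [hi_apply]⟩
  let θ : Multiplicative (ZMod (2 * n)) × Multiplicative (ZMod 2) ≃*
      Multiplicative (ZMod (2 * n)) × Multiplicative (ZMod 2) := MulEquiv.inv _
  have hθ_apply : ∀ u, θ u = u⁻¹ := fun u => rfl
  have hθ : ∀ u, ((xa 0, 1) : QuaternionGroup n × Multiplicative (ZMod 2)) * i u = i (θ u) * (xa 0, 1) := by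
    rintro ⟨u₁, u₂⟩
    simp [hi_apply, hθ_apply, inv_eq_self_zmod_two]
  set c : Multiplicative (ZMod (2 * n)) × Multiplicative (ZMod 2) := (Multiplicative.ofAdd (n : ZMod (2 * n)), 1)
    with hc_def
  have hic : i c = (a n, 1) := rfl
  have hxx : ((xa 0, 1) : QuaternionGroup n × Multiplicative (ZMod 2)) * (xa 0, 1) = i c := by simp [hic]
  have hnn : (n : ZMod (2 * n)) + n = 0 := by
    rw [← two_mul]
    exact_mod_cast ZMod.natCast_self (2 * n)
  have hcc : c * c = 1 := by
    rw [hc_def, Prod.mk_mul_mk, mul_one, ← ofAdd_add, hnn]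
    rfl
  have hθc : θ c = c := by
    rw [hθ_apply, hc_def, Prod.inv_mk, inv_one]
    change (Multiplicative.ofAdd (-(n : ZMod (2 * n))), (1 : Multiplicative (ZMod 2))) = _
    rw [neg_eq_of_add_eq_zero_left hnn]
  -- the two sheets
  set S₁ : Finset (Multiplicative (ZMod (2 * n)) × Multiplicative (ZMod 2)) :=
    Finset.univ.filter fun u => i u ∈ S with hS₁_def
  set S₂ : Finset (Multiplicative (ZMod (2 * n)) × Multiplicative (ZMod 2)) :=
    Finset.univ.filter fun u => i u * (xa 0, 1) ∈ S with hS₂_def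
  have hS₁ : ∀ u, u ∈ S₁ ↔ i u ∈ S := fun u => by simp [hS₁_def]
  have hS₂ : ∀ u, u ∈ S₂ ↔ i u * (xa 0, 1) ∈ S := fun u => by simp [hS₂_def]
  have hS₁cm : IsCMTypeWith c (↑S₁ : Set (Multiplicative (ZMod (2 * n)) × Multiplicative (ZMod 2))) := by
    refine ⟨fun u => ?_, fun g u => ?_, fun u => ?_⟩
    · rw [Finset.mem_coe, Finset.mem_coe, hS₁, hS₁, smul_eq_mul, map_mul, hic, hScm, not_not]
    · simp only [smul_eq_mul, mul_left_comm]
    · rw [smul_eq_mul, smul_eq_mul, ← mul_assoc, hcc, one_mul]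
  have hS₂cm : IsCMTypeWith c (↑S₂ : Set (Multiplicative (ZMod (2 * n)) × Multiplicative (ZMod 2))) := by
    refine ⟨fun u => ?_, fun g u => ?_, fun u => ?_⟩
    · rw [Finset.mem_coe, Finset.mem_coe, hS₂, hS₂, smul_eq_mul, map_mul, hic, mul_assoc, hScm, not_not]
    · simp only [smul_eq_mul, mul_left_comm]
    · rw [smul_eq_mul, smul_eq_mul, ← mul_assoc, hcc, one_mul]
  -- left translation by `i τ` versus right translation of the sheets by `τ` (`τ` central)
  have hτ : ∀ τ u : Multiplicative (ZMod (2 * n)) × Multiplicative (ZMod 2), i τ * i u = i (u * τ) := fun τ u => by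
    rw [← map_mul, mul_comm τ u]
  have hstab_of : ∀ τ : Multiplicative (ZMod (2 * n)) × Multiplicative (ZMod 2),
      (∀ u, u ∈ S₁ ↔ u * τ ∈ S₁) → (∀ u, u ∈ S₂ ↔ u * τ ∈ S₂) →
      ∀ w : QuaternionGroup n × Multiplicative (ZMod 2), w ∈ S ↔ i τ * w ∈ S := by
    intro τ h1 h2 w
    rcases hcov w with ⟨u, rfl⟩ | ⟨u, rfl⟩
    · rw [← hS₁, h1 u, hS₁, hτ]
    · rw [← hS₂, h2 u, hS₂, ← mul_assoc, hτ]
  -- the determinant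
  have hdet : ∀ χ : AddChar (Additive (Multiplicative (ZMod (2 * n)) × Multiplicative (ZMod 2))) ℂ,
      χ (Additive.ofMul c) = -1 →
      (∑ s ∈ S₁, χ (Additive.ofMul s)) * (∑ s ∈ S₁, χ (Additive.ofMul (θ s))) -
        χ (Additive.ofMul c) * ((∑ t ∈ S₂, χ (Additive.ofMul t)) * (∑ t ∈ S₂, χ (Additive.ofMul (θ t)))) ≠ 0 := by
    intro χ hχ hΔ
    have hconj : ∀ u, χ (Additive.ofMul (θ u)) = starRingEnd ℂ (χ (Additive.ofMul u)) := fun u => by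
      rw [hθ_apply, ofMul_inv, AddChar.map_neg_eq_conj]
    simp_rw [hconj] at hΔ
    rw [← map_sum (starRingEnd ℂ), ← map_sum (starRingEnd ℂ), hχ] at hΔ
    obtain ⟨h1, h2⟩ := eq_zero_of_mul_conj_add_mul_conj_eq_zero (z := ∑ s ∈ S₁, χ (Additive.ofMul s))
      (w := ∑ t ∈ S₂, χ (Additive.ofMul t)) (by linear_combination hΔ)
    have hp1 := translate_mem_iff_of_sum_eq_zero hn hS₁cm χ hχ h1
    have hp2 := translate_mem_iff_of_sum_eq_zero hn hS₂cm χ hχ h2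
    rcases character_snd_eq_or χ with hε | hε
    · exact hstab₁ (hstab_of _ (hp1.1 hε) (hp2.1 hε))
    · exact hstab₂ (hstab_of _ (hp1.2 hε) (hp2.2 hε))
  exact TwoSheet.eq_zero_of_twoSheet i hi (xa 0, 1) hx hcov θ hθ c hxx hcc hθc S S₁ S₂ hS₁ hS₂ hdet b
    (fun g => by rw [hic]; exact hb g) hann

end Model

/-! ## §2 Nondegeneracy and the Hodge conjecture -/

section Field

variable {n : ℕ} [NeZero n]
variable {K : Type} [Field K] [NumberField K] [IsCMField K] [IsGalois ℚ K]

omit [IsCMField K] in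
/-- `[K:ℚ] = 8n`. [folklore] -/
theorem finrank_eq_eight_mul (e : (K ≃ₐ[ℚ] K) ≃* QuaternionGroup n × Multiplicative (ZMod 2)) :
    Module.finrank ℚ K = 8 * n := by
  rw [← card_model_eq_finrank e, Fintype.card_prod, QuaternionGroup.card, Fintype.card_multiplicative, ZMod.card]
  ring

/-- **THEOREM.  `Gal(K/ℚ) ≅ Q_{2^{k+2}} × C₂` with complex conjugation `(a n, 1)` (`n = 2^k`): every PRIMITIVE CM type
of `K` is NONDEGENERATE** (rank `4n + 1`). [cite: Kubota1965, §4 Lemma 2] [cite: Shimura1998, §8.2 Prop. 26] -/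
theorem isNondegenerate_of_isPrimitive_quaternion_times_two {k : ℕ} (hn : n = 2 ^ k)
    (e : (K ≃ₐ[ℚ] K) ≃* QuaternionGroup n × Multiplicative (ZMod 2))
    (hc : e ((IsCMField.complexConj K).restrictScalars ℚ) = (a n, 1)) {Φ : CMType K} (φ₀ : K →+* ℂ)
    (hprim : IsPrimitive (ℂ ≃+* ℂ) Φ.1 φ₀) : IsNondegenerate Φ := by
  classical
  set S : Finset (QuaternionGroup n × Multiplicative (ZMod 2)) :=
    Finset.univ.filter fun y => embOf φ₀ (e.symm y) ∈ Φ.1 with hS_def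
  have hS : ∀ y, y ∈ S ↔ embOf φ₀ (e.symm y) ∈ Φ.1 := fun y => by
    simp only [hS_def, Finset.mem_filter, Finset.mem_univ, true_and]
  have hScm := model_mul_mem_iff e hc Φ φ₀ S hS
  have hz : (Multiplicative.ofAdd (1 : ZMod 2)) ≠ 1 := by decide
  have hv1 : ((a n, Multiplicative.ofAdd 1) : QuaternionGroup n × Multiplicative (ZMod 2)) ≠ 1 := fun h =>
    hz (congrArg Prod.snd h)
  have hv2 : ((1, Multiplicative.ofAdd 1) : QuaternionGroup n × Multiplicative (ZMod 2)) ≠ 1 := fun h =>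
    hz (congrArg Prod.snd h)
  refine (isNondegenerate_iff_forall_annihilator e hc Φ φ₀ S hS).2 fun b hb hann =>
    eq_zero_of_annihilated_quaternion_times_two hn S hScm
      (fun h => not_isPrimitive_of_leftStabiliser e Φ φ₀ S hS hv1 h hprim)
      (fun h => not_isPrimitive_of_leftStabiliser e Φ φ₀ S hS hv2 h hprim) b hb hann

/-- The rank: `cmTypeRank Φ = 4n + 1`. [cite: Kubota1965, §2 (p. 115)] -/
theorem cmTypeRank_eq_of_isPrimitive_quaternion_times_two {k : ℕ} (hn : n = 2 ^ k)
    (e : (K ≃ₐ[ℚ] K) ≃* QuaternionGroup n × Multiplicative (ZMod 2))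
    (hc : e ((IsCMField.complexConj K).restrictScalars ℚ) = (a n, 1)) {Φ : CMType K} (φ₀ : K →+* ℂ)
    (hprim : IsPrimitive (ℂ ≃+* ℂ) Φ.1 φ₀) : cmTypeRank Φ = 4 * n + 1 := by
  have h := isNondegenerate_of_isPrimitive_quaternion_times_two hn e hc φ₀ hprim
  rw [isNondegenerate_iff, finrank_eq_eight_mul e] at h
  rw [h]; omega

variable {Φ : CMType K} {A : AbelianVariety ℂ} {ι : 𝓞 K →+* End A}
  {θ : K →+* Module.End ℂ (complexBetti A.X 1)}

/-- **THE HODGE CONJECTURE FOR EVERY POWER OF EVERY SIMPLE ABELIAN VARIETY (of dimension `2^{k+2}`) WITH COMPLEX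
MULTIPLICATION BY A GALOIS CM FIELD WITH GROUP `Q_{2^{k+2}} × C₂` and complex conjugation in the quaternion factor**
(`K` = a quaternion CM field times a real quadratic field) — unconditionally. [cite: Gordon1999HodgeAVSurvey, Thm. 6.4]
[cite: Shimura1998, §8.2 Prop. 26] -/
theorem hodgeConjectureFor_pow_of_isSimple_quaternion_times_two {k : ℕ} (hn : n = 2 ^ k)
    (e : (K ≃ₐ[ℚ] K) ≃* QuaternionGroup n × Multiplicative (ZMod 2))
    (hc : e ((IsCMField.complexConj K).restrictScalars ℚ) = (a n, 1)) (hA : IsCMTypeRealisation Φ A ι θ)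
    (hs : A.IsSimple) (N : ℕ) : HodgeConjectureFor (⨁ fun _ : Fin N => A).dim (⨁ fun _ : Fin N => A).X := by
  obtain ⟨φ₀⟩ := (inferInstance : Nonempty (K →+* ℂ))
  exact (isNondegenerate_of_isPrimitive_quaternion_times_two hn e hc φ₀
    ((isSimple_iff_isPrimitive hA φ₀).1 hs)).hodgeConjectureFor_pow hA N

/-- The simple abelian variety itself. [cite: Gordon1999HodgeAVSurvey, Thm. 6.4] -/
theorem hodgeConjectureFor_of_isSimple_quaternion_times_two {k : ℕ} (hn : n = 2 ^ k)
    (e : (K ≃ₐ[ℚ] K) ≃* QuaternionGroup n × Multiplicative (ZMod 2))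
    (hc : e ((IsCMField.complexConj K).restrictScalars ℚ) = (a n, 1)) (hA : IsCMTypeRealisation Φ A ι θ)
    (hs : A.IsSimple) : HodgeConjectureFor A.dim A.X := by
  obtain ⟨φ₀⟩ := (inferInstance : Nonempty (K →+* ℂ))
  exact (isNondegenerate_of_isPrimitive_quaternion_times_two hn e hc φ₀
    ((isSimple_iff_isPrimitive hA φ₀).1 hs)).hodgeConjectureFor hA

/-- `Bᵐ(Aⁿ) ⊗ ℂ = Dᵐ(Aⁿ) ⊗ ℂ` on every power (White–Hazama). [cite: Gordon1999HodgeAVSurvey, §9.3] -/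
theorem hodgeClassSpan_pow_eq_divisorClassesSpan_of_isSimple_quaternion_times_two {k : ℕ} (hn : n = 2 ^ k)
    (e : (K ≃ₐ[ℚ] K) ≃* QuaternionGroup n × Multiplicative (ZMod 2))
    (hc : e ((IsCMField.complexConj K).restrictScalars ℚ) = (a n, 1)) (hA : IsCMTypeRealisation Φ A ι θ)
    (hs : A.IsSimple) (N m : ℕ) :
    Literature.AlgebraicGeometry.VanGeemen1994.hodgeClassSpan (⨁ fun _ : Fin N => A).dim (⨁ fun _ : Fin N => A).X m =
      Literature.Barriers.HodgeConjecture.divisorClassesSpan (⨁ fun _ : Fin N => A).X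
        (⨁ fun _ : Fin N => A).dim m := by
  obtain ⟨φ₀⟩ := (inferInstance : Nonempty (K →+* ℂ))
  exact (isNondegenerate_of_isPrimitive_quaternion_times_two hn e hc φ₀
    ((isSimple_iff_isPrimitive hA φ₀).1 hs)).hodgeClassSpan_pow_eq_divisorClassesSpan hA N m

end Field

/-! ## §3 `End⁰`-action binder and class-target display -/

section Binders

open Literature.AlgebraicGeometry Literature.AlgebraicGeometry.Motives.AbelianVariety
open Literature.AlgebraicGeometry.ComplexMultiplication
open Summit.HodgeConjecture.HodgeConjecture.Ring2.ClassTargets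

variable {n : ℕ} [NeZero n]
variable {F : Type} [Field F] [NumberField F] [IsCMField F] [IsGalois ℚ F]

/-- **The Hodge conjecture for every complex abelian variety isogenous to a power `X^{N+1}` of a SIMPLE abelian
variety `X` of dimension `2^{k+2}` with an action `φ : F →+* End⁰(X)` of a Galois CM field `F` with
`Gal(F/ℚ) ≅ Q_{2^{k+2}} × C₂`, complex conjugation in the quaternion factor** — unconditionally.
[cite: Shimura1998, §7.1 Prop. 7 and §5.2] [cite: Gordon1999HodgeAVSurvey, Thm. 6.3–6.4 and §9.4] -/
theorem hodgeConjectureFor_of_isIsogenous_powSucc_of_ringHom_quaternion_times_two {k : ℕ} (hn : n = 2 ^ k)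
    (e : (F ≃ₐ[ℚ] F) ≃* QuaternionGroup n × Multiplicative (ZMod 2))
    (hc : e ((IsCMField.complexConj F).restrictScalars ℚ) = (a n, 1)) {X : AbelianVariety ℂ} (hXs : X.IsSimple)
    (hXd : X.dim = 4 * n) (φ : F →+* X.endAlgebra) {B : AbelianVariety ℂ} {N : ℕ}
    (h : IsIsogenous B (X.powSucc N)) : HodgeConjectureFor B.dim B.X := by
  obtain ⟨X', φ', ι', hφι, f, hf⟩ := exists_principal_pair φ
  have hdim' : Module.finrank ℚ F = 2 * X'.dim := by
    rw [finrank_eq_eight_mul e, ← dim_eq_of_isIsogeny hf, hXd]; ring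
  have hreal := isCMTypeRealisation_cmTypeOfPair φ' hdim' ι' hφι
  obtain ⟨s₀⟩ := (inferInstance : Nonempty (F →+* ℂ))
  have hΦ := isNondegenerate_of_isPrimitive_quaternion_times_two hn e hc s₀
    ((isSimple_iff_isPrimitive hreal s₀).1 (hXs.of_isIsogeny hf))
  exact hodgeConjectureFor_of_isDivisorGenerated _
    (hΦ.isDivisorGenerated_of_isIsogenous_powSucc hreal (h.trans (isIsogenous_powSucc ⟨f, hf⟩ N)))

/-- **HC on the class «isogenous to a power of a SIMPLE abelian variety of dimension `2^{k+2}` with an action of a Galois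
CM field `F`, `Gal(F/ℚ) ≅ Q_{2^{k+2}} × C₂`, complex conjugation `(a^{2^k}, 1)`»**, UNCONDITIONAL.
[cite: Gordon1999HodgeAVSurvey, Thm. 6.3–6.4 and §9.4] -/
theorem hcOnClass_isIsogenous_powSucc_simple_galoisCM_quaternion_times_two :
    HCOnClass fun B ↦ ∃ (X : AbelianVariety ℂ) (N : ℕ) (F : Type) (_ : Field F) (_ : NumberField F)
      (_ : IsCMField F) (_ : IsGalois ℚ F) (n k : ℕ) (_ : NeZero n)
      (e : (F ≃ₐ[ℚ] F) ≃* QuaternionGroup n × Multiplicative (ZMod 2)),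
      n = 2 ^ k ∧ e ((IsCMField.complexConj F).restrictScalars ℚ) = (a n, 1) ∧ X.IsSimple ∧ X.dim = 4 * n ∧
      Nonempty (F →+* X.endAlgebra) ∧ IsIsogenous B (X.powSucc N) := by
  rintro B ⟨X, N, F, _, _, _, _, n, k, _, e, hn, hc, hXs, hXd, ⟨φ⟩, h⟩
  exact hodgeConjectureFor_of_isIsogenous_powSucc_of_ringHom_quaternion_times_two hn e hc hXs hXd φ h

end Binders

end Summit.HodgeConjecture.CorCM.GaloisDicyclic

end
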